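import Literature.AnabelianGeometry.EtaleTheta.Discharge.Sec2HasMuLModelChiCusp
import Literature.AnabelianGeometry.EtaleTheta.Discharge.Sec2BarDeltaBridgeLe
import Literature.AnabelianGeometry.EtaleTheta.ThetaCoversModelHeisenberg
import Literature.AnabelianGeometry.EtaleTheta.SettingModelChiBarKerHuu
import HarnessLib

/-!
# [EtTh] Rmk. 2.6.1 at the Kummer-carrying `χ′`: for THE R312 cover of record, the typed hypothesis `HasMuL`
# («`Π_C` acts trivially on `Δ̄_Θ`») holds IFF `l ∣ p − 1` — print's «`μ_l ⊆ K`» is NECESSARY and sufficient (proof-only)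

S. Mochizuki, *The étale theta function and its Frobenioid-theoretic manifestations*, Publ. RIMS **45** (2009) [EtTh], §2:
Rmk. 2.6.1 p. 40 («Suppose, for simplicity, that `K` contains a primitive `l`-th root of unity»), Def. 2.1 p. 35 («`Δ̄_X`»,
«`Δ̄_Θ ≅ (ℤ/lℤ)(1)`») [cite: MochizukiEtTh2009, Rmk 2.6.1 p.40]. Cell abc-iut, layer L2, seat abc-iut-L2-t10 (gen 7), successor
row of R609 «HASMUL ITSELF @ χ′ ⟺ l ∣ p−1». PROOF-ONLY (0 definitions). Companion of `Sec2HasMuLModelChiCusp` (p466422), which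
decided the §1 ANTECEDENT `hμ` at the χ-models and gave `HasMuL` for `l ∣ p − 1`; this file decides `HasMuL` ITSELF.

THE ARGUMENT (all inputs BY NAME). `T :=` the `temperedCoverDataOfHuuOfSection` term of `nonempty_orbitEmbedding_inversionModelχ'`
(`Π_C := toPiCHat`, section cusp datum); `T.HasMuL` reads `∀ c ∈ Π_C, ∀ t ∈ Δ̄_Θ-preimage, [c, t] ∈ Ker(Δ_X ↠ Δ̄_X)` with
`Δ̄_Θ`-preimage `= incl(barThetaHat l)`, `Ker = incl(barKerHat l)` (abc-iut-L2-t10 gen 4/5's `PiCData.barTheta_eq_map` /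
`barKer_eq_map`). Take `t := incl(toHat x₀)`, `x₀ := inl(c^1) ∈ Π^tp_X` the commutator-axis generator (`toHat x₀ ∈ barThetaHat`,
`barThetaTp` route), and `c := incl(toHat(inr σ))`. Then `[c, t] = incl(toHat [inr σ, x₀])` and `toHat [inr σ, x₀] = inl(u·(c^1)⁻¹)`
with `u ≡ c^{χ(σ)}` modulo `[[F̂₂,F̂₂],F̂₂]⁻` (abc-iut-L6-d6's `conj_inl_cPow_mul_inv_mem_closure₃`). The level-`l` Heisenberg
character `ĥ_l ∘ (Δ_X ≅ F̂₂) : Δ_X → Heis(ℤ/l)` (continuous; class two, `Heis.commutator_commutator_top_eq_bot`; exponent `l` for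
odd `l`, abc-iut-L2-d1's `Heis.pow_eq_one_of_odd`) KILLS `barKerHat l` (gen 4's `apply_eq_one_of_mem_barKerHat`) but maps that
element to `(0, 0, χ_l(σ) − 1)` (abc-iut-w5-d024's `hHat_powHat_commutator`, `ZHatLevel.toAdd_level_aut`). So:

* `hHat_conjLeft_mul_inv_cPow` — `ĥ_l(u·(c^1)⁻¹) = (0, 0, χ_l(σ) − 1)`;
* `toHat_commutator_inr_cElement_not_mem_barKerHat` — for odd `l` and `χ_l(σ) ≠ 1`, `toHat [inr σ, x₀] ∉ barKerHat l` at `modelχ′`;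
* `toHat_cElement_mem_barThetaHat` — `toHat x₀ ∈ barThetaHat l`;
* **`not_hasMuL_coverOfRecordχ'_of_levelChar_ne_one`**, **`hasMuL_coverOfRecordχ'_iff`** — for odd `l`, every `E / C / eX` and
  arbitrary `Prop` inputs `hK hsH hι`: **`T.HasMuL ↔ l ∣ p − 1`** (`←` = p466422's `hasMuL_coverOfRecordχ'`; `→` by the above with
  abc-iut-w5-d125's `exists_levelChar_chi_ne_one_iff`, the clause `p = 2 ∧ l = 2` being void for odd `l`).

CENSUS CONSEQUENCE: at the Kummer-carrying `χ′` the antecedent of abc-iut-L2-t2's `Rmk261` / `Cor29_card` is NOT idle (contrast `κ′`,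
K10 v2: `HasMuL` for every `l`): print's «`μ_l ⊆ K`» is necessary AND sufficient there. HONEST LIMITS: semi-synthetic model, SECTION
cusp datum = consistency / tightness evidence for the typed interface only; nothing of [EtTh] asserted; no side taken on [IUTchIII]
Cor. 3.12; typed ≠ proved; instantiated ≠ endorsed.
-/

noncomputable section

open CategoryTheory ProfiniteGrp ProfiniteGrp.ProfiniteCompletion
open scoped commutatorElement

namespace Literature.AnabelianGeometry.EtaleTheta.SettingModel

open Literature.AnabelianGeometry.SemiGraphs ThetaCovers ThetaSetting

variable (p : ℕ) [Fact p.Prime]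

/-! ### The level-`l` Heisenberg value of `[inr σ, c^1]` -/

/-- **`ĥ_l` of the `F̂₂`-component of `toHat [inr σ, inl c^1]` is `(0, 0, χ_l(σ) − 1)`**: the conjugate of `inl(c^1)` over `σ` has
`F̂₂`-component `≡ c^{χ(σ)}` modulo `[[F̂₂,F̂₂],F̂₂]⁻`, which `ĥ_l` kills. [cite: MochizukiEtTh2009, §1 p.12] -/
theorem hHat_conjLeft_mul_inv_cPow (N : ℕ+) (σ : GQp p) :
    hHat N (gfpFst ((SemidirectProduct.inr σ * SemidirectProduct.inl (cGfpχ (ZHatLevel.eta 1)) *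
        (SemidirectProduct.inr σ)⁻¹ : PiTpχ p).left) *
        (powHat (eta ⁅FreeGroup.of (0 : Fin 2), FreeGroup.of 1⁆) (ZHatLevel.eta 1))⁻¹) =
      ⟨0, 0, ZHatLevel.levelChar N (chi p σ) - 1⟩ := by
  set u := gfpFst ((SemidirectProduct.inr σ * SemidirectProduct.inl (cGfpχ (ZHatLevel.eta 1)) *
    (SemidirectProduct.inr σ)⁻¹ : PiTpχ p).left) with hu
  have hmem := conj_inl_cPow_mul_inv_mem_closure₃ p _ powHat_commutator_spec
    (SemidirectProduct.inr σ : PiTpχ p) (ZHatLevel.eta 1)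
  rw [SemidirectProduct.right_inr] at hmem
  have h1 : hHat N (u * (powHat (eta ⁅FreeGroup.of (0 : Fin 2), FreeGroup.of 1⁆)
      (chi p σ (ZHatLevel.eta 1)))⁻¹) = 1 := hHat_eq_one_of_mem_closure N hmem
  have key : u * (powHat (eta ⁅FreeGroup.of (0 : Fin 2), FreeGroup.of 1⁆) (ZHatLevel.eta 1))⁻¹ =
      (u * (powHat (eta ⁅FreeGroup.of (0 : Fin 2), FreeGroup.of 1⁆) (chi p σ (ZHatLevel.eta 1)))⁻¹) *
        (powHat (eta ⁅FreeGroup.of (0 : Fin 2), FreeGroup.of 1⁆) (chi p σ (ZHatLevel.eta 1)) *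
          (powHat (eta ⁅FreeGroup.of (0 : Fin 2), FreeGroup.of 1⁆) (ZHatLevel.eta 1))⁻¹) := by group
  rw [key, map_mul, h1, one_mul, map_mul, map_inv, hHat_powHat_commutator, hHat_powHat_commutator,
    ZHatLevel.toAdd_level_aut, ZHatLevel.level_eta, toAdd_ofAdd, Int.cast_one, mul_one]
  ext <;> simp [sub_eq_add_neg]

/-! ### At `modelχ′`: `toHat [inr σ, x₀] ∉ barKerHat l` when `χ_l(σ) ≠ 1`, and `toHat x₀ ∈ barThetaHat l` -/

/-- `toHat` of the χ-models on elements: `F̂₂`-component `gfpFst ∘ left`, Galois component `right`; so an element with trivial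
Galois component goes to `inl(gfpFst left)`. [cite: MochizukiEtTh2009, §1 p.12] -/
theorem toHat_modelχ'_eq_inl_of_right_eq_one (w : PiTpχ p) (hw : w.right = 1) :
    (ThetaSetting.modelχ' p).toHat w = SemidirectProduct.inl (gfpFst w.left) := by
  refine SemidirectProduct.ext ?_ ?_
  · rw [SemidirectProduct.left_inl]; rfl
  · rw [SemidirectProduct.right_inl]; exact hw

/-- **For odd `l` and `χ_l(σ) ≠ 1`, `toHat [inr σ, inl c^1] ∉ Ker(Δ_X ↠ Δ̄_X)` at `modelχ′`**: the level-`l` Heisenberg character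
`ĥ_l ∘ (Δ_X ≅ F̂₂)` kills `barKerHat l` (class two, exponent `l`) but takes the value `(0, 0, χ_l(σ) − 1) ≠ 1` there.
[cite: MochizukiEtTh2009, Def 2.1 p.35] -/
theorem toHat_commutator_inr_cElement_not_mem_barKerHat (l : ℕ+) (hodd : Odd (l : ℕ)) {σ : GQp p}
    (hσ : ZHatLevel.levelChar l (chi p σ) ≠ 1) :
    (ThetaSetting.modelχ' p).toHat
        (SemidirectProduct.inr σ * SemidirectProduct.inl (cGfpχ (ZHatLevel.eta 1)) * (SemidirectProduct.inr σ)⁻¹ *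
          (SemidirectProduct.inl (cGfpχ (ZHatLevel.eta 1)))⁻¹) ∉
      (ThetaSetting.modelχ' p).barKerHat l := by
  set g : PiTpχ p := SemidirectProduct.inr σ * SemidirectProduct.inl (cGfpχ (ZHatLevel.eta 1)) *
    (SemidirectProduct.inr σ)⁻¹ with hg
  set x₀ : PiTpχ p := SemidirectProduct.inl (cGfpχ (ZHatLevel.eta 1)) with hx₀
  have hgr : g.right = 1 := by simp [hg, hx₀]
  have hx₀inv : x₀⁻¹ = SemidirectProduct.inl ((cGfpχ (ZHatLevel.eta 1))⁻¹) := by rw [hx₀, map_inv]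
  have hwr : (g * x₀⁻¹).right = 1 := by
    rw [hx₀inv, SemidirectProduct.mul_right, hgr, SemidirectProduct.right_inl, mul_one]
  have hwl : gfpFst (g * x₀⁻¹).left =
      gfpFst g.left * (powHat (eta ⁅FreeGroup.of (0 : Fin 2), FreeGroup.of 1⁆) (ZHatLevel.eta 1))⁻¹ := by
    rw [hx₀inv, SemidirectProduct.mul_left, SemidirectProduct.left_inl, hgr, map_one, MulAut.one_apply, map_mul, map_inv,
      gfpFst_cGfpχ]
  have hval : hHat l (gfpFst (g * x₀⁻¹).left) = ⟨0, 0, ZHatLevel.levelChar l (chi p σ) - 1⟩ := by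
    rw [hwl, hg, hHat_conjLeft_mul_inv_cPow]
  intro hmem
  rw [toHat_modelχ'_eq_inl_of_right_eq_one p _ hwr] at hmem
  -- the level-`l` Heisenberg character of `Δ_X`
  let F : (ThetaSetting.modelχ' p).DeltaHat →* Heis (ZMod l) :=
    (hHat l).toMonoidHom.comp (deltaHatχEquiv p).symm.toMonoidHom
  have hF : Continuous F := (hHat l).continuous.comp (deltaHatχEquiv p).symm.continuous
  have h3 : ∀ q ∈ (⁅⁅(⊤ : Subgroup (Heis (ZMod l))), (⊤ : Subgroup (Heis (ZMod l)))⁆,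
      (⊤ : Subgroup (Heis (ZMod l)))⁆ : Subgroup (Heis (ZMod l))), q = 1 := fun q hq => by
    rwa [Heis.commutator_commutator_top_eq_bot, Subgroup.mem_bot] at hq
  have hkill := ThetaSetting.apply_eq_one_of_mem_barKerHat (D := ThetaSetting.modelχ' p) (l : ℕ) F hF h3
    (Heis.pow_eq_one_of_odd l hodd) (g := ⟨SemidirectProduct.inl (gfpFst (g * x₀⁻¹).left), inl_mem_deltaHatχ p _⟩) hmem
  have hFval : F ⟨SemidirectProduct.inl (gfpFst (g * x₀⁻¹).left), inl_mem_deltaHatχ p _⟩ =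
      hHat l (gfpFst (g * x₀⁻¹).left) := rfl
  rw [hFval, hval] at hkill
  apply hσ
  have hz := congrArg Heis.z hkill
  simp only [Heis.one_z] at hz
  exact sub_eq_zero.mp hz

/-- **`toHat(inl c^1) ∈ Δ̄_Θ-preimage `barThetaHat l`** at `modelχ′` (`inl c^1 ∈ Δ^tp_X` with `θ(inl c^1) = c^{η 1} ∈ Δ_Θ`, so
`inl c^1 ∈ barThetaTp l`; then `barThetaTp_le_comap_barThetaHat`). [cite: MochizukiEtTh2009, Def 2.1 p.35] -/
theorem toHat_cElement_mem_barThetaHat (l : ℕ) :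
    (ThetaSetting.modelχ' p).toHat (SemidirectProduct.inl (cGfpχ (ZHatLevel.eta 1))) ∈ (ThetaSetting.modelχ' p).barThetaHat l := by
  refine (ThetaSetting.modelχ' p).barThetaTp_le_comap_barThetaHat l (((ThetaSetting.modelχ' p).mem_barThetaTp_iff l).mpr ⟨?_, ?_⟩)
  · exact (mem_deltaTempχ_iff p _).mpr (SemidirectProduct.right_inl _)
  · exact Subgroup.mem_sup_right (cThetaχ_mem_ker p (ZHatLevel.eta 1))

/-! ### `HasMuL` for THE R312 cover of record at `χ′` ⟺ `l ∣ p − 1` -/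

/-- **`HasMuL` FAILS for THE R312 cover of record at `χ′` whenever `χ_l(σ) ≠ 1` for some `σ ∈ G_{ℚ_p}`** (odd `l`): the pair
`c := incl(toHat(inr σ))`, `t := incl(toHat(inl c^1))` violates it. [cite: MochizukiEtTh2009, Rmk 2.6.1 p.40] -/
theorem not_hasMuL_coverOfRecordχ'_of_levelChar_ne_one {E : (ThetaSetting.modelχ' p).EtaleThetaData} {l : ℕ+}
    (hodd : Odd (l : ℕ)) {σ : GQp p} (hσ : ZHatLevel.levelChar l (chi p σ) ≠ 1) (C : E.DoubleUnderline (l : ℕ))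
    (eX : (ThetaSetting.modelχ' p).OncePuncturedData)
    (hK : (MuTwoSetting.inversionModelχ' p).barKerTp l ≤ C.Huu) (hsH : ∀ σ, sectionχ' p σ ∈ C.Huu)
    (hι : C.IotaStable ((cLevelDataInvχ' p).conjX (epsPMInvχ p))) :
    ¬ ((cLevelDataInvχ' p).temperedCoverDataOfHuuOfSection (cLevelDataInvχ' p).toPiCHat
      (cLevelDataInvχ' p).isProfiniteCompletion_toPiCHat (cLevelDataInvχ' p).toPiCHat_injective eX hodd (sectionχ' p)
      (aug_sectionχ' p) (toZ_sectionχ' p) (inv_ell_piCData_inversionModelχ' p l eX)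
      ((cLevelDataInvχ' p).map_inclX_GtpXu_normal l (kerToZIsCompactlyGenerated_modelχ' p))
      ((cLevelDataInvχ' p).map_inclX_GtpY_normal (kerToZIsCompactlyGenerated_modelχ' p)) C hK hsH
      (epsPMInvχ_not_mem_range p) hι).HasMuL := by
  intro hMuL
  set I := (cLevelDataInvχ' p).piCData with hI
  set D := ThetaSetting.modelχ' p with hD
  set x₀ : PiTpχ p := SemidirectProduct.inl (cGfpχ (ZHatLevel.eta 1)) with hx₀
  set g : PiTpχ p := SemidirectProduct.inr σ with hg
  have ht : I.incl (D.toHat x₀) ∈ I.barTheta l := by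
    rw [I.barTheta_eq_map l eX]
    exact ⟨D.toHat x₀, toHat_cElement_mem_barThetaHat p l, rfl⟩
  have h : I.incl (D.toHat g) * I.incl (D.toHat x₀) * (I.incl (D.toHat g))⁻¹ * (I.incl (D.toHat x₀))⁻¹ ∈ I.barKer l :=
    hMuL (I.incl (D.toHat g)) (I.incl (D.toHat x₀)) ht
  have h' : I.incl (D.toHat (g * x₀ * g⁻¹ * x₀⁻¹)) ∈ I.barKer l := by simpa only [map_mul, map_inv] using h
  rw [I.barKer_eq_map l eX] at h'
  obtain ⟨y, hy, hyEq⟩ := h'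
  have hyEq' : y = D.toHat (g * x₀ * g⁻¹ * x₀⁻¹) := I.incl_injective hyEq
  rw [hyEq'] at hy
  exact toHat_commutator_inr_cElement_not_mem_barKerHat p l hodd hσ hy

/-- **[EtTh] Rmk. 2.6.1's hypothesis at the Kummer-carrying `χ′`, DECIDED: for THE R312 cover of record `T` (odd `l`, any `E / C / eX`,
arbitrary `Prop` inputs), `T.HasMuL ↔ l ∣ p − 1`** — print's «`K ⊇ μ_l`» (`K = ℚ_p`) is NECESSARY (this file) and SUFFICIENT (p466422's
`hasMuL_coverOfRecordχ'`). [cite: MochizukiEtTh2009, Rmk 2.6.1 p.40] -/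
theorem hasMuL_coverOfRecordχ'_iff {E : (ThetaSetting.modelχ' p).EtaleThetaData} {l : ℕ+} (hodd : Odd (l : ℕ))
    (C : E.DoubleUnderline (l : ℕ)) (eX : (ThetaSetting.modelχ' p).OncePuncturedData)
    (hK : (MuTwoSetting.inversionModelχ' p).barKerTp l ≤ C.Huu) (hsH : ∀ σ, sectionχ' p σ ∈ C.Huu)
    (hι : C.IotaStable ((cLevelDataInvχ' p).conjX (epsPMInvχ p))) :
    ((cLevelDataInvχ' p).temperedCoverDataOfHuuOfSection (cLevelDataInvχ' p).toPiCHat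
      (cLevelDataInvχ' p).isProfiniteCompletion_toPiCHat (cLevelDataInvχ' p).toPiCHat_injective eX hodd (sectionχ' p)
      (aug_sectionχ' p) (toZ_sectionχ' p) (inv_ell_piCData_inversionModelχ' p l eX)
      ((cLevelDataInvχ' p).map_inclX_GtpXu_normal l (kerToZIsCompactlyGenerated_modelχ' p))
      ((cLevelDataInvχ' p).map_inclX_GtpY_normal (kerToZIsCompactlyGenerated_modelχ' p)) C hK hsH
      (epsPMInvχ_not_mem_range p) hι).HasMuL ↔ (l : ℕ) ∣ p - 1 := by
  refine ⟨fun hMuL => ?_, fun hl => hasMuL_coverOfRecordχ' p hodd hl C eX hK hsH hι⟩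
  by_contra hl
  have hne : ¬ ((l : ℕ) ∣ p - 1 ∨ (p = 2 ∧ ((l : ℕ+) : ℕ) = 2)) := by
    rintro (h | ⟨-, h2⟩)
    · exact hl h
    · rw [h2] at hodd
      exact (Nat.not_even_iff_odd.mpr hodd) even_two
  obtain ⟨σ, hσ⟩ := (exists_levelChar_chi_ne_one_iff p l).mpr hne
  exact not_hasMuL_coverOfRecordχ'_of_levelChar_ne_one p hodd hσ C eX hK hsH hι hMuL

/-- **THE χ′ CENSUS, NEGATIVE HALF**: for odd `l ∤ p − 1` and every `E / C` with `Π^tp_{X̲̲} = Huuχ p l`, THE R312 cover of record does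
NOT satisfy `HasMuL` — so abc-iut-L2-t2's `Rmk261` / `Cor29_card` hold there VACUOUSLY (their antecedent is false), exactly as print
restricts to `μ_l ⊆ K`. [cite: MochizukiEtTh2009, Rmk 2.6.1 p.40] -/
theorem not_hasMuL_coverOfRecordχ'_of_not_dvd {E : (ThetaSetting.modelχ' p).EtaleThetaData} {l : ℕ+} (hodd : Odd (l : ℕ))
    (hl : ¬ (l : ℕ) ∣ p - 1) (C : E.DoubleUnderline (l : ℕ)) (hC : C.Huu = Huuχ p l)
    (eX : (ThetaSetting.modelχ' p).OncePuncturedData) :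
    ¬ ((cLevelDataInvχ' p).temperedCoverDataOfHuuOfSection (cLevelDataInvχ' p).toPiCHat
      (cLevelDataInvχ' p).isProfiniteCompletion_toPiCHat (cLevelDataInvχ' p).toPiCHat_injective eX hodd (sectionχ' p)
      (aug_sectionχ' p) (toZ_sectionχ' p) (inv_ell_piCData_inversionModelχ' p l eX)
      ((cLevelDataInvχ' p).map_inclX_GtpXu_normal l (kerToZIsCompactlyGenerated_modelχ' p))
      ((cLevelDataInvχ' p).map_inclX_GtpY_normal (kerToZIsCompactlyGenerated_modelχ' p)) C
      (hC ▸ barKerTp_le_Huuχ_inversionModelχ' p l hodd) (fun σ => by rw [hC]; exact inr_mem_Huuχ p l σ)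
      (epsPMInvχ_not_mem_range p) (iotaStable_conjX_epsPMInvχ' p C hC)).HasMuL :=
  fun h => hl ((hasMuL_coverOfRecordχ'_iff p hodd C eX _ _ _).mp h)

end Literature.AnabelianGeometry.EtaleTheta.SettingModel

end
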